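/-
Copyright (c) 2026. All rights reserved.
Released under Apache 2.0 license as described in the file LICENSE.
Authors: abc-iut cell, wave-4 seat abc-iut-w4-d059 (proof-only; piece (P-A″) of the (AI4″) producer: the
auxiliary compact completion ELIMINATED — the `stabBranchPairAug` conclusion from finite-level statements
about the acting group itself).
-/
import Literature.AnabelianGeometry.SemiGraphs.ArithBranchPairOrbit
import Literature.AnabelianGeometry.SemiGraphs.CompactCompletionFaithful
import Literature.AnabelianGeometry.SemiGraphs.TemperedBranchPairProfinite
import HarnessLib

/-!
# [SemiAnbd] Thm 5.4 (i) p. 66: the (AI4″) branch-pair conclusion from finite-level dictionaries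
# (proof-only; the compact completion eliminated)

Mochizuki, *Semi-graphs of anabelioids*, Publ. RIMS **42** (2006), proof of Thm 3.7 (iii) p. 41 (with the
author's Comments (6)(b): identifications "in the profinite topology") and Thm 5.4 (i) p. 66 ("entirely
parallel"). [cite: MochizukiSemiAnbd2006, Thm 5.4 (i) p.66]

PROOF-ONLY file (abc-iut cell, sub-DAG `plan/L3/SUBDAG-SemiAnbd-Thm54.md`, producer row T54-B, piece
(P-A″) of the (AI4″) producer `stabBranchPairAug`, seat abc-iut-w4-d059).  The compact group `Q` of
`map_aug_le_conj_of_stabilizer` (ArithBranchPairOrbit) is SUPPLIED here by abc-iut-w4-d029's compact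
completion of the level tower (`exists_compactCompletion_faithful`, with its density transfers
`qAct_levelTrans_of_denseRange`, `ker_qAct_le_of_denseRange` and the cofinality consequence
`iInf_ker_qAct_eq_bot`), and the `Q`-dictionaries are DERIVED from finite-level `E`-dictionaries
(`CompactOrbit.forall_apply_eq_iff_mem_map_of_ker`, the variant of the (P-A′-Q) dictionary lemma with a
separate open kernel family).  Result: `map_aug_le_conj_of_levelDict` — the field text of
`ArithLevelDataCpt.stabBranchPairAug` for an acting topological group `E` with continuous `aug : E → Π_A`
(`Π_A` compact Hausdorff), finite levels with open antitone kernels, reference data `(ω, κs)`, levelwise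
transitivity (T1)/(T2) by elements of `E`, finite-level `E`-dictionaries of the reference data for the
decomposition groups of `D` (compact), arithmetic cofinality `hcof`, and faithfulness of the tower plus
`aug` on `Π_{v₀}`.  No `Q` appears in the statement.  Preferred variant `map_aug_le_conj_of_levelDict'`:
`hκE`/`hBc` replaced by the pro-level `hκE'` ("`v ∈ Π_{v₀}` fixing every `κs b₀ j` lies in `Π_{b₀}`").

No definition, no new named fact; nothing here takes a side on [IUTchIII] Cor. 3.12.
-/

namespace Literature.AnabelianGeometry.SemiGraphs

open CategoryTheory Topology
open scoped Pointwise

universe v u w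

namespace CompactOrbit

/-- **The stabiliser in the completion from a levelwise dictionary, relative to an open kernel family**
(variant of `forall_apply_eq_iff_mem_map`): `K_j ≤ ker φ_j` open, antitone, with trivial intersection;
if every `e ∈ E` fixing `s_j` is `v · k` with `v ∈ V`, `ιQ k ∈ K_j`, and `V` fixes `s`, then the
`Q`-stabiliser of `s` is `ιQ(V)` (`ιQ(V)` compact, `ιQ` dense). [cite: MochizukiSemiAnbd2006, Thm 3.7(iii) p.41] -/
theorem forall_apply_eq_iff_mem_map_of_ker {Q : Type u} [Group Q] [TopologicalSpace Q]
    [IsTopologicalGroup Q] [T2Space Q] {E : Type*} [Group E] (ιQ : E →* Q) (hdense : DenseRange ιQ)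
    {J : Type v} [Preorder J] [IsDirectedOrder J] [Nonempty J]
    {X : J → Type w} (φ : ∀ j, Q →* Function.End (X j)) (K : J → Subgroup Q)
    (hKφ : ∀ j, K j ≤ (φ j).ker) (hK : ∀ j, IsOpen (K j : Set Q))
    (hanti : ∀ ⦃i j : J⦄, i ≤ j → K j ≤ K i) (hbot : ∀ q : Q, (∀ j, q ∈ K j) → q = 1)
    (V : Subgroup E) (hVc : IsCompact ((V.map ιQ : Subgroup Q) : Set Q)) (s : ∀ j, X j)
    (hE : ∀ (j : J) (e : E), φ j (ιQ e) (s j) = s j → ∃ v ∈ V, ιQ (v⁻¹ * e) ∈ K j)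
    (hV : ∀ v ∈ V, ∀ j, φ j (ιQ v) (s j) = s j) (q : Q) :
    (∀ j, φ j q (s j) = s j) ↔ q ∈ V.map ιQ := by
  constructor
  · intro hq
    have hmem : ∀ j, q ∈ ((V.map ιQ : Subgroup Q) : Set Q) * (K j : Set Q) := by
      intro j
      have hopen : IsOpen {y : Q | q⁻¹ * y ∈ K j} := (hK j).preimage (continuous_const.mul continuous_id)
      obtain ⟨e, he⟩ := hdense.exists_mem_open hopen
        ⟨q, show q⁻¹ * q ∈ K j by rw [inv_mul_cancel]; exact (K j).one_mem⟩
      have hn : φ j (q⁻¹ * ιQ e) = 1 := hKφ j he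
      have hfix : φ j (ιQ e) (s j) = s j := by
        have h1 : ιQ e = q * (q⁻¹ * ιQ e) := (mul_inv_cancel_left q (ιQ e)).symm
        rw [h1, map_mul, hn, mul_one, hq j]
      obtain ⟨v, hv, hve⟩ := hE j e hfix
      refine Set.mem_mul.mpr ⟨ιQ v, ⟨v, hv, rfl⟩, ιQ (v⁻¹ * e) * (q⁻¹ * ιQ e)⁻¹,
        (K j).mul_mem hve ((K j).inv_mem he), ?_⟩
      rw [map_mul, map_inv]
      group
    have hdir : ∀ i j : J, ∃ k, K k ≤ K i ∧ K k ≤ K j := by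
      intro i j
      obtain ⟨k, hik, hjk⟩ := exists_ge_ge i j
      exact ⟨k, hanti hik, hanti hjk⟩
    have := iInter_mul_coe_eq_of_isCompact K hK hdir hbot hVc
    have hq' : q ∈ ⋂ j, ((V.map ιQ : Subgroup Q) : Set Q) * (K j : Set Q) := Set.mem_iInter.mpr hmem
    rw [this] at hq'
    exact hq'
  · rintro ⟨v, hv, rfl⟩
    exact hV v hv

end CompactOrbit

section LevelDict

variable {E : Type u} [Group E] [TopologicalSpace E] [IsTopologicalGroup E]
  {PA : Type u} [Group PA] [TopologicalSpace PA] [IsTopologicalGroup PA] [CompactSpace PA] [T2Space PA]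
  {J : Type v} [Preorder J] [IsDirectedOrder J]
  (G : J → SemiGraph.{u}) [∀ j, Finite (G j).Vertex] [∀ j, Finite (G j).Branch]
  (levelAct : ∀ j, E →* Aut (G j)) (gf : ∀ ⦃i j : J⦄, i ≤ j → (G j ⟶ G i))

/-- **The (AI4″) branch-pair conclusion from finite-level dictionaries** (`stabBranchPairAug` of
abc-iut-w4-d053's `ArithLevelDataCpt`, the compact completion eliminated): see the module docstring for
the list of inputs; the conclusion is VERBATIM that of `map_aug_le_conj_of_stabilizer`.
[cite: MochizukiSemiAnbd2006, Thm 5.4 (i) p.66] -/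
theorem map_aug_le_conj_of_levelDict (aug : E →* PA) (haugc : Continuous aug)
    (hker : ∀ j, IsOpen ((levelAct j).ker : Set E))
    (hanti : ∀ ⦃i j : J⦄, i ≤ j → (levelAct j).ker ≤ (levelAct i).ker)
    (hgfe : ∀ ⦃i j : J⦄ (h : i ≤ j) (e : E), (levelAct j e).hom ≫ gf h = gf h ≫ (levelAct i e).hom)
    {Base : SemiGraph.{u}} (proj : ∀ j, G j ⟶ Base)
    (hprojTrans : ∀ ⦃i j : J⦄ (h : i ≤ j), gf h ≫ proj i = proj j)
    (v₀ : Base.Vertex) (ω : ∀ j, (G j).Vertex) (hωv : ∀ j, (proj j).vertexMap (ω j) = v₀)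
    (hω : ∀ ⦃i j : J⦄ (h : i ≤ j), (gf h).vertexMap (ω j) = ω i)
    (κs : Base.Branch → ∀ j, (G j).Branch)
    (hκs : ∀ (b₀ : Base.Branch), Base.abuts b₀ = some v₀ →
      (∀ j, (G j).abuts (κs b₀ j) = some (ω j) ∧ (proj j).branchMap (κs b₀ j) = b₀) ∧
        ∀ ⦃i j : J⦄ (h : i ≤ j), (gf h).branchMap (κs b₀ j) = κs b₀ i)
    (htrans₁ : ∀ (j : J) (x : (G j).Vertex) (γ : (G j).Branch) (b₀ : Base.Branch),
      (proj j).vertexMap x = v₀ → (G j).abuts γ = some x → (proj j).branchMap γ = b₀ →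
      ∃ e : E, (levelAct j e).hom.vertexMap (ω j) = x ∧ (levelAct j e).hom.branchMap (κs b₀ j) = γ)
    (htrans₂ : ∀ (j : J) (γ : (G j).Branch) (b₀ : Base.Branch),
      (G j).abuts γ = some (ω j) → (proj j).branchMap γ = b₀ →
      ∃ e : E, (∀ i, (levelAct i e).hom.vertexMap (ω i) = ω i) ∧
        (levelAct j e).hom.branchMap (κs b₀ j) = γ)
    (j₀ : J) (w : ∀ i : {i : J // j₀ ≤ i}, (G i.1).Vertex) (β β' : ∀ i : {i : J // j₀ ≤ i}, (G i.1).Branch)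
    (hpair : ∀ i, β i ≠ β' i ∧ (G i.1).abuts (β i) = some (w i) ∧ (G i.1).abuts (β' i) = some (w i))
    (hcompat : ∀ ⦃i i' : {i : J // j₀ ≤ i}⦄ (h : i.1 ≤ i'.1), (gf h).vertexMap (w i') = w i ∧
      (gf h).branchMap (β i') = β i ∧ (gf h).branchMap (β' i') = β' i)
    (hbase : ∀ i : {i : J // j₀ ≤ i}, (proj i.1).vertexMap (w i) = v₀)
    (D : DecompositionData E Base.Vertex Base.Branch) (hDabut : ∀ b₀, D.abut b₀ = Base.abuts b₀)
    (hVc : IsCompact ((D.vertGp v₀ : Subgroup E) : Set E))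
    (hBc : ∀ b₀ : Base.Branch, Base.abuts b₀ = some v₀ → IsCompact ((D.brGp b₀ : Subgroup E) : Set E))
    (hωE : ∀ (j : J) (e : E), (levelAct j e).hom.vertexMap (ω j) = ω j →
      ∃ v ∈ D.vertGp v₀, v⁻¹ * e ∈ (levelAct j).ker)
    (hωV : ∀ v ∈ D.vertGp v₀, ∀ j, (levelAct j v).hom.vertexMap (ω j) = ω j)
    (hκE : ∀ (b₀ : Base.Branch), Base.abuts b₀ = some v₀ → ∀ (j : J) (e : E),
      (levelAct j e).hom.vertexMap (ω j) = ω j → (levelAct j e).hom.branchMap (κs b₀ j) = κs b₀ j →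
      ∃ v ∈ D.brGp b₀, v⁻¹ * e ∈ (levelAct j).ker)
    (hκV : ∀ (b₀ : Base.Branch), Base.abuts b₀ = some v₀ → ∀ v ∈ D.brGp b₀, ∀ j,
      (levelAct j v).hom.vertexMap (ω j) = ω j ∧ (levelAct j v).hom.branchMap (κs b₀ j) = κs b₀ j)
    (hcof : ∀ U ∈ 𝓝 (1 : PA), ∃ j, ∀ e ∈ (levelAct j).ker, aug e ∈ U)
    (hfaith : ∀ v ∈ D.vertGp v₀, (∀ j, levelAct j v = 1) → aug v = 1 → v = 1)
    (C : Subgroup E)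
    (hC : ∀ (i : {i : J // j₀ ≤ i}) (e : E), e ∈ C → (levelAct i.1 e).hom.vertexMap (w i) = w i ∧
      (levelAct i.1 e).hom.branchMap (β i) = β i ∧ (levelAct i.1 e).hom.branchMap (β' i) = β' i) :
    ∃ (v : Base.Vertex) (b b' : Base.Branch) (a : PA) (h : E), D.abut b = some v ∧ D.abut b' = some v ∧
      h ∈ D.vertGp v ∧ (b' ≠ b ∨ h ∉ D.brGp b) ∧
      C.map aug ≤ conjSubgroup a ((D.brGp b ⊓ conjSubgroup h (D.brGp b')).map aug) := by
  classical
  haveI : Nonempty J := ⟨j₀⟩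
  -- the compact completion of the level tower (abc-iut-w4-d029)
  obtain ⟨Q, _, _, _, _, _, ιQ, qAct, augQ, hdense, hqker, hqAct, haugQ, hιker, hqfaith⟩ :=
    exists_compactCompletion_faithful aug haugc G levelAct hker
  -- density transfers
  have hgfeQ : ∀ ⦃i j : J⦄ (h : i ≤ j) (q : Q), (qAct j q).hom ≫ gf h = gf h ≫ (qAct i q).hom :=
    fun i j h q => qAct_levelTrans_of_denseRange ιQ hdense G levelAct qAct hqker hqAct gf hgfe h q
  have hantiQ : ∀ ⦃i j : J⦄, i ≤ j → (qAct j).ker ≤ (qAct i).ker :=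
    fun i j h => ker_qAct_le_of_denseRange ιQ hdense G levelAct qAct hqker hqAct (hanti h)
  have hbotQ : ∀ q : Q, (∀ j, q ∈ (qAct j).ker) → q = 1 := by
    intro q hq
    have h := iInf_ker_qAct_eq_bot aug ιQ hdense G levelAct qAct hqker hqAct augQ haugQ hqfaith hcof
    have : q ∈ (⨅ j, (qAct j).ker) := Subgroup.mem_iInf.mpr hq
    rw [h] at this
    exact (Subgroup.mem_bot).mp this
  -- the vertex and (vertex, branch) actions as monoid homomorphisms with kernels above `ker qAct`
  let φV : ∀ j, Q →* Function.End (G j).Vertex := fun j =>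
    { toFun := fun q => fun z : (G j).Vertex => (qAct j q).hom.vertexMap z
      map_one' := by funext z; show (qAct j 1).hom.vertexMap z = z; rw [map_one]; rfl
      map_mul' := fun a b => by
        funext z; show (qAct j (a * b)).hom.vertexMap z = _; rw [map_mul]; rfl }
  let φP : ∀ j, Q →* Function.End ((G j).Vertex × (G j).Branch) := fun j =>
    { toFun := fun q => fun p => ((qAct j q).hom.vertexMap p.1, (qAct j q).hom.branchMap p.2)
      map_one' := by
        funext p
        show ((qAct j 1).hom.vertexMap p.1, (qAct j 1).hom.branchMap p.2) = p
        rw [map_one]; rfl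
      map_mul' := fun a b => by
        funext p
        show ((qAct j (a * b)).hom.vertexMap p.1, (qAct j (a * b)).hom.branchMap p.2) = _
        rw [map_mul]; rfl }
  have hφV : ∀ j, (qAct j).ker ≤ (φV j).ker := fun j q hq => by
    rw [MonoidHom.mem_ker] at hq ⊢
    funext z; show (qAct j q).hom.vertexMap z = z; rw [hq]; rfl
  have hφP : ∀ j, (qAct j).ker ≤ (φP j).ker := fun j q hq => by
    rw [MonoidHom.mem_ker] at hq ⊢
    funext p; show ((qAct j q).hom.vertexMap p.1, (qAct j q).hom.branchMap p.2) = p; rw [hq]; rfl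
  -- compact images
  have himV : IsCompact (((D.vertGp v₀).map ιQ.toMonoidHom : Subgroup Q) : Set Q) := by
    rw [Subgroup.coe_map]; exact hVc.image ιQ.continuous
  have himB : ∀ b₀, Base.abuts b₀ = some v₀ →
      IsCompact (((D.brGp b₀).map ιQ.toMonoidHom : Subgroup Q) : Set Q) := fun b₀ hb₀ => by
    rw [Subgroup.coe_map]; exact (hBc b₀ hb₀).image ιQ.continuous
  -- the Q-dictionaries from the E-dictionaries
  have hω_dict : ∀ q : Q, (∀ j, (qAct j q).hom.vertexMap (ω j) = ω j) ↔
      q ∈ (D.vertGp v₀).map ιQ.toMonoidHom := fun q =>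
    CompactOrbit.forall_apply_eq_iff_mem_map_of_ker ιQ.toMonoidHom hdense φV (fun j => (qAct j).ker)
      hφV hqker hantiQ hbotQ (D.vertGp v₀) himV ω
      (fun j e he => by
        obtain ⟨v, hv, hve⟩ := hωE j e (by
          have : (qAct j (ιQ e)).hom.vertexMap (ω j) = ω j := he
          rwa [hqAct] at this)
        refine ⟨v, hv, ?_⟩
        show qAct j (ιQ (v⁻¹ * e)) = 1
        rw [hqAct]; exact hve)
      (fun v hv j => by
        show (qAct j (ιQ v)).hom.vertexMap (ω j) = ω j
        rw [hqAct]; exact hωV v hv j) q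
  have hκ_dict : ∀ b₀ : Base.Branch, Base.abuts b₀ = some v₀ → ∀ q : Q,
      (∀ j, (qAct j q).hom.vertexMap (ω j) = ω j ∧ (qAct j q).hom.branchMap (κs b₀ j) = κs b₀ j) ↔
        q ∈ (D.brGp b₀).map ιQ.toMonoidHom := fun b₀ hb₀ q => by
    have key := CompactOrbit.forall_apply_eq_iff_mem_map_of_ker ιQ.toMonoidHom hdense φP
      (fun j => (qAct j).ker) hφP hqker hantiQ hbotQ (D.brGp b₀) (himB b₀ hb₀) (fun j => (ω j, κs b₀ j))
      (fun j e he => by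
        have he' : ((qAct j (ιQ e)).hom.vertexMap (ω j), (qAct j (ιQ e)).hom.branchMap (κs b₀ j)) =
            (ω j, κs b₀ j) := he
        rw [hqAct] at he'
        obtain ⟨v, hv, hve⟩ := hκE b₀ hb₀ j e (congrArg Prod.fst he') (congrArg Prod.snd he')
        refine ⟨v, hv, ?_⟩
        show qAct j (ιQ (v⁻¹ * e)) = 1
        rw [hqAct]; exact hve)
      (fun v hv j => by
        show ((qAct j (ιQ v)).hom.vertexMap (ω j), (qAct j (ιQ v)).hom.branchMap (κs b₀ j)) =
          (ω j, κs b₀ j)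
        rw [hqAct]; exact Prod.ext (hκV b₀ hb₀ v hv j).1 (hκV b₀ hb₀ v hv j).2) q
    rw [← key]
    refine forall_congr' fun j => ?_
    change _ ↔ ((qAct j q).hom.vertexMap (ω j), (qAct j q).hom.branchMap (κs b₀ j)) = (ω j, κs b₀ j)
    constructor
    · rintro ⟨h1, h2⟩; exact Prod.ext h1 h2
    · intro h; exact ⟨congrArg Prod.fst h, congrArg Prod.snd h⟩
  -- injectivity of `ιQ` on `Π_{v₀}` from the kernel computation and faithfulness
  have hinj : Set.InjOn ιQ.toMonoidHom (D.vertGp v₀) := by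
    intro a ha b hb hab
    have hmem : a⁻¹ * b ∈ ιQ.toMonoidHom.ker := by
      rw [MonoidHom.mem_ker, map_mul, map_inv]
      exact inv_mul_eq_one.mpr hab
    rw [hιker] at hmem
    obtain ⟨h1, h2⟩ := Subgroup.mem_inf.mp hmem
    have hab' : a⁻¹ * b = 1 := hfaith (a⁻¹ * b) ((D.vertGp v₀).mul_mem ((D.vertGp v₀).inv_mem ha) hb)
      (fun j => (MonoidHom.mem_ker).mp (Subgroup.mem_iInf.mp h1 j)) ((MonoidHom.mem_ker).mp h2)
    exact inv_mul_eq_one.mp hab'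
  -- transitivity at the `Q`-level
  have htrans₁Q : ∀ (j : J) (x : (G j).Vertex) (γ : (G j).Branch) (b₀ : Base.Branch),
      (proj j).vertexMap x = v₀ → (G j).abuts γ = some x → (proj j).branchMap γ = b₀ →
      ∃ q : Q, (qAct j q).hom.vertexMap (ω j) = x ∧ (qAct j q).hom.branchMap (κs b₀ j) = γ := by
    intro j x γ b₀ hx hγ hb
    obtain ⟨e, he⟩ := htrans₁ j x γ b₀ hx hγ hb
    exact ⟨ιQ e, by rw [hqAct]; exact he⟩
  have htrans₂Q : ∀ (j : J) (γ : (G j).Branch) (b₀ : Base.Branch),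
      (G j).abuts γ = some (ω j) → (proj j).branchMap γ = b₀ →
      ∃ a : Q, (∀ i, (qAct i a).hom.vertexMap (ω i) = ω i) ∧ (qAct j a).hom.branchMap (κs b₀ j) = γ := by
    intro j γ b₀ hγ hb
    obtain ⟨e, he₁, he₂⟩ := htrans₂ j γ b₀ hγ hb
    exact ⟨ιQ e, fun i => by rw [hqAct]; exact he₁ i, by rw [hqAct]; exact he₂⟩
  -- apply the `Q`-level theorem
  exact map_aug_le_conj_of_stabilizer G qAct gf hqker hgfeQ proj hprojTrans v₀ ω hωv hω κs hκs htrans₁Q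
    htrans₂Q j₀ w β β' hpair hcompat hbase ιQ.toMonoidHom aug augQ.toMonoidHom haugQ D hDabut hω_dict
    hκ_dict hinj C (fun i e he => by
      show (qAct i.1 (ιQ e)).hom.vertexMap (w i) = w i ∧ (qAct i.1 (ιQ e)).hom.branchMap (β i) = β i ∧
        (qAct i.1 (ιQ e)).hom.branchMap (β' i) = β' i
      rw [hqAct]; exact hC i e he)

/-- **The (AI4″) branch-pair conclusion from the finite-level VERTEX dictionary** (preferred variant of
`map_aug_le_conj_of_levelDict`): the levelwise branch-pair dictionary `hκE` and the compactness of the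
branch groups are replaced by the single PRO-level statement `hκE'` — an element of `Π_{v₀}` fixing the
reference branch classes `κs b₀ j` at EVERY level lies in `Π_{b₀}` (the `Q`-dictionary of the pair is then
read off the vertex dictionary: `Stab_Q(ω, κs b₀) = ιQ(Π_{v₀} ∩ Stab(κs b₀)) = ιQ(Π_{b₀})`).
[cite: MochizukiSemiAnbd2006, Thm 5.4 (i) p.66] -/
theorem map_aug_le_conj_of_levelDict' (aug : E →* PA) (haugc : Continuous aug)
    (hker : ∀ j, IsOpen ((levelAct j).ker : Set E))
    (hanti : ∀ ⦃i j : J⦄, i ≤ j → (levelAct j).ker ≤ (levelAct i).ker)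
    (hgfe : ∀ ⦃i j : J⦄ (h : i ≤ j) (e : E), (levelAct j e).hom ≫ gf h = gf h ≫ (levelAct i e).hom)
    {Base : SemiGraph.{u}} (proj : ∀ j, G j ⟶ Base)
    (hprojTrans : ∀ ⦃i j : J⦄ (h : i ≤ j), gf h ≫ proj i = proj j)
    (v₀ : Base.Vertex) (ω : ∀ j, (G j).Vertex) (hωv : ∀ j, (proj j).vertexMap (ω j) = v₀)
    (hω : ∀ ⦃i j : J⦄ (h : i ≤ j), (gf h).vertexMap (ω j) = ω i)
    (κs : Base.Branch → ∀ j, (G j).Branch)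
    (hκs : ∀ (b₀ : Base.Branch), Base.abuts b₀ = some v₀ →
      (∀ j, (G j).abuts (κs b₀ j) = some (ω j) ∧ (proj j).branchMap (κs b₀ j) = b₀) ∧
        ∀ ⦃i j : J⦄ (h : i ≤ j), (gf h).branchMap (κs b₀ j) = κs b₀ i)
    (htrans₁ : ∀ (j : J) (x : (G j).Vertex) (γ : (G j).Branch) (b₀ : Base.Branch),
      (proj j).vertexMap x = v₀ → (G j).abuts γ = some x → (proj j).branchMap γ = b₀ →
      ∃ e : E, (levelAct j e).hom.vertexMap (ω j) = x ∧ (levelAct j e).hom.branchMap (κs b₀ j) = γ)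
    (htrans₂ : ∀ (j : J) (γ : (G j).Branch) (b₀ : Base.Branch),
      (G j).abuts γ = some (ω j) → (proj j).branchMap γ = b₀ →
      ∃ e : E, (∀ i, (levelAct i e).hom.vertexMap (ω i) = ω i) ∧
        (levelAct j e).hom.branchMap (κs b₀ j) = γ)
    (j₀ : J) (w : ∀ i : {i : J // j₀ ≤ i}, (G i.1).Vertex) (β β' : ∀ i : {i : J // j₀ ≤ i}, (G i.1).Branch)
    (hpair : ∀ i, β i ≠ β' i ∧ (G i.1).abuts (β i) = some (w i) ∧ (G i.1).abuts (β' i) = some (w i))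
    (hcompat : ∀ ⦃i i' : {i : J // j₀ ≤ i}⦄ (h : i.1 ≤ i'.1), (gf h).vertexMap (w i') = w i ∧
      (gf h).branchMap (β i') = β i ∧ (gf h).branchMap (β' i') = β' i)
    (hbase : ∀ i : {i : J // j₀ ≤ i}, (proj i.1).vertexMap (w i) = v₀)
    (D : DecompositionData E Base.Vertex Base.Branch) (hDabut : ∀ b₀, D.abut b₀ = Base.abuts b₀)
    (hVc : IsCompact ((D.vertGp v₀ : Subgroup E) : Set E))
    (hωE : ∀ (j : J) (e : E), (levelAct j e).hom.vertexMap (ω j) = ω j →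
      ∃ v ∈ D.vertGp v₀, v⁻¹ * e ∈ (levelAct j).ker)
    (hωV : ∀ v ∈ D.vertGp v₀, ∀ j, (levelAct j v).hom.vertexMap (ω j) = ω j)
    (hκE' : ∀ (b₀ : Base.Branch), Base.abuts b₀ = some v₀ → ∀ v ∈ D.vertGp v₀,
      (∀ j, (levelAct j v).hom.branchMap (κs b₀ j) = κs b₀ j) → v ∈ D.brGp b₀)
    (hκV : ∀ (b₀ : Base.Branch), Base.abuts b₀ = some v₀ → ∀ v ∈ D.brGp b₀, ∀ j,
      (levelAct j v).hom.vertexMap (ω j) = ω j ∧ (levelAct j v).hom.branchMap (κs b₀ j) = κs b₀ j)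
    (hcof : ∀ U ∈ 𝓝 (1 : PA), ∃ j, ∀ e ∈ (levelAct j).ker, aug e ∈ U)
    (hfaith : ∀ v ∈ D.vertGp v₀, (∀ j, levelAct j v = 1) → aug v = 1 → v = 1)
    (C : Subgroup E)
    (hC : ∀ (i : {i : J // j₀ ≤ i}) (e : E), e ∈ C → (levelAct i.1 e).hom.vertexMap (w i) = w i ∧
      (levelAct i.1 e).hom.branchMap (β i) = β i ∧ (levelAct i.1 e).hom.branchMap (β' i) = β' i) :
    ∃ (v : Base.Vertex) (b b' : Base.Branch) (a : PA) (h : E), D.abut b = some v ∧ D.abut b' = some v ∧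
      h ∈ D.vertGp v ∧ (b' ≠ b ∨ h ∉ D.brGp b) ∧
      C.map aug ≤ conjSubgroup a ((D.brGp b ⊓ conjSubgroup h (D.brGp b')).map aug) := by
  classical
  haveI : Nonempty J := ⟨j₀⟩
  -- the compact completion of the level tower (abc-iut-w4-d029)
  obtain ⟨Q, _, _, _, _, _, ιQ, qAct, augQ, hdense, hqker, hqAct, haugQ, hιker, hqfaith⟩ :=
    exists_compactCompletion_faithful aug haugc G levelAct hker
  -- density transfers
  have hgfeQ : ∀ ⦃i j : J⦄ (h : i ≤ j) (q : Q), (qAct j q).hom ≫ gf h = gf h ≫ (qAct i q).hom :=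
    fun i j h q => qAct_levelTrans_of_denseRange ιQ hdense G levelAct qAct hqker hqAct gf hgfe h q
  have hantiQ : ∀ ⦃i j : J⦄, i ≤ j → (qAct j).ker ≤ (qAct i).ker :=
    fun i j h => ker_qAct_le_of_denseRange ιQ hdense G levelAct qAct hqker hqAct (hanti h)
  have hbotQ : ∀ q : Q, (∀ j, q ∈ (qAct j).ker) → q = 1 := by
    intro q hq
    have h := iInf_ker_qAct_eq_bot aug ιQ hdense G levelAct qAct hqker hqAct augQ haugQ hqfaith hcof
    have : q ∈ (⨅ j, (qAct j).ker) := Subgroup.mem_iInf.mpr hq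
    rw [h] at this
    exact (Subgroup.mem_bot).mp this
  -- the vertex action as monoid homomorphisms with kernels above `ker qAct`
  let φV : ∀ j, Q →* Function.End (G j).Vertex := fun j =>
    { toFun := fun q => fun z : (G j).Vertex => (qAct j q).hom.vertexMap z
      map_one' := by funext z; show (qAct j 1).hom.vertexMap z = z; rw [map_one]; rfl
      map_mul' := fun a b => by
        funext z; show (qAct j (a * b)).hom.vertexMap z = _; rw [map_mul]; rfl }
  have hφV : ∀ j, (qAct j).ker ≤ (φV j).ker := fun j q hq => by
    rw [MonoidHom.mem_ker] at hq ⊢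
    funext z; show (qAct j q).hom.vertexMap z = z; rw [hq]; rfl
  -- compact images
  have himV : IsCompact (((D.vertGp v₀).map ιQ.toMonoidHom : Subgroup Q) : Set Q) := by
    rw [Subgroup.coe_map]; exact hVc.image ιQ.continuous
  -- the Q-dictionaries from the E-dictionaries
  have hω_dict : ∀ q : Q, (∀ j, (qAct j q).hom.vertexMap (ω j) = ω j) ↔
      q ∈ (D.vertGp v₀).map ιQ.toMonoidHom := fun q =>
    CompactOrbit.forall_apply_eq_iff_mem_map_of_ker ιQ.toMonoidHom hdense φV (fun j => (qAct j).ker)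
      hφV hqker hantiQ hbotQ (D.vertGp v₀) himV ω
      (fun j e he => by
        obtain ⟨v, hv, hve⟩ := hωE j e (by
          have : (qAct j (ιQ e)).hom.vertexMap (ω j) = ω j := he
          rwa [hqAct] at this)
        refine ⟨v, hv, ?_⟩
        show qAct j (ιQ (v⁻¹ * e)) = 1
        rw [hqAct]; exact hve)
      (fun v hv j => by
        show (qAct j (ιQ v)).hom.vertexMap (ω j) = ω j
        rw [hqAct]; exact hωV v hv j) q
  have hκ_dict : ∀ b₀ : Base.Branch, Base.abuts b₀ = some v₀ → ∀ q : Q,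
      (∀ j, (qAct j q).hom.vertexMap (ω j) = ω j ∧ (qAct j q).hom.branchMap (κs b₀ j) = κs b₀ j) ↔
        q ∈ (D.brGp b₀).map ιQ.toMonoidHom := fun b₀ hb₀ q => by
    constructor
    · intro h
      obtain ⟨v, hv, hvq⟩ := (hω_dict q).mp fun j => (h j).1
      refine ⟨v, hκE' b₀ hb₀ v hv fun j => ?_, hvq⟩
      have := (h j).2
      rw [← hvq] at this
      change (qAct j (ιQ v)).hom.branchMap (κs b₀ j) = κs b₀ j at this
      rwa [hqAct] at this
    · rintro ⟨v, hv, rfl⟩ j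
      change (qAct j (ιQ v)).hom.vertexMap (ω j) = ω j ∧ (qAct j (ιQ v)).hom.branchMap (κs b₀ j) = κs b₀ j
      rw [hqAct]; exact hκV b₀ hb₀ v hv j
  -- injectivity of `ιQ` on `Π_{v₀}` from the kernel computation and faithfulness
  have hinj : Set.InjOn ιQ.toMonoidHom (D.vertGp v₀) := by
    intro a ha b hb hab
    have hmem : a⁻¹ * b ∈ ιQ.toMonoidHom.ker := by
      rw [MonoidHom.mem_ker, map_mul, map_inv]
      exact inv_mul_eq_one.mpr hab
    rw [hιker] at hmem
    obtain ⟨h1, h2⟩ := Subgroup.mem_inf.mp hmem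
    have hab' : a⁻¹ * b = 1 := hfaith (a⁻¹ * b) ((D.vertGp v₀).mul_mem ((D.vertGp v₀).inv_mem ha) hb)
      (fun j => (MonoidHom.mem_ker).mp (Subgroup.mem_iInf.mp h1 j)) ((MonoidHom.mem_ker).mp h2)
    exact inv_mul_eq_one.mp hab'
  -- transitivity at the `Q`-level
  have htrans₁Q : ∀ (j : J) (x : (G j).Vertex) (γ : (G j).Branch) (b₀ : Base.Branch),
      (proj j).vertexMap x = v₀ → (G j).abuts γ = some x → (proj j).branchMap γ = b₀ →
      ∃ q : Q, (qAct j q).hom.vertexMap (ω j) = x ∧ (qAct j q).hom.branchMap (κs b₀ j) = γ := by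
    intro j x γ b₀ hx hγ hb
    obtain ⟨e, he⟩ := htrans₁ j x γ b₀ hx hγ hb
    exact ⟨ιQ e, by rw [hqAct]; exact he⟩
  have htrans₂Q : ∀ (j : J) (γ : (G j).Branch) (b₀ : Base.Branch),
      (G j).abuts γ = some (ω j) → (proj j).branchMap γ = b₀ →
      ∃ a : Q, (∀ i, (qAct i a).hom.vertexMap (ω i) = ω i) ∧ (qAct j a).hom.branchMap (κs b₀ j) = γ := by
    intro j γ b₀ hγ hb
    obtain ⟨e, he₁, he₂⟩ := htrans₂ j γ b₀ hγ hb
    exact ⟨ιQ e, fun i => by rw [hqAct]; exact he₁ i, by rw [hqAct]; exact he₂⟩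
  -- apply the `Q`-level theorem
  exact map_aug_le_conj_of_stabilizer G qAct gf hqker hgfeQ proj hprojTrans v₀ ω hωv hω κs hκs htrans₁Q
    htrans₂Q j₀ w β β' hpair hcompat hbase ιQ.toMonoidHom aug augQ.toMonoidHom haugQ D hDabut hω_dict
    hκ_dict hinj C (fun i e he => by
      show (qAct i.1 (ιQ e)).hom.vertexMap (w i) = w i ∧ (qAct i.1 (ιQ e)).hom.branchMap (β i) = β i ∧
        (qAct i.1 (ιQ e)).hom.branchMap (β' i) = β' i
      rw [hqAct]; exact hC i e he)

end LevelDict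

end Literature.AnabelianGeometry.SemiGraphs
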